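import Summits.CriticalPhenomena.PercolationContinuityZ3.Theorems.PercNearOneGluingNoHeavyQuantFarHairyCycle
import Summits.CriticalPhenomena.PercolationContinuityZ3.Theorems.PercNearOneGluingNoHeavyQuantFarSunCertFiveTwo
import HarnessLib

/-!
# FAR beyond trees: `Quant.FarRelayRow` holds on EVERY hairy cycle with at most five pendant relays (all lengths, all weights, all layers)

builds on p205010 (kernel theorem, internal audit signed; external expert review pending)

Support file (`--supports stmt-CriticalPhenomena-4575`), seat `prim-cert-1` (gen 18); QUANT lane rung R8, front "FAR beyond trees" (lead g20,
2026-08-21 — "prove the first cyclic family: a cycle of gates with pendant relays").  Assembly of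

* the SEGMENT REDUCTION `HairyCycle.farp_of_sun` (`…QuantFarHairyCycle`): FAR on a hairy cycle with `K` hairs ⟸ FAR on the sun graph
  `C_{K+1}` for every weight function vanishing off it, and
* the exact two-copy certificates `TwoCopy.farp_sun3_j1`, `farp_sun4_j1`, `farp_sun5_j1`, `farp_sun5_j2`
  (`…QuantFarSunCert`, `…Five`, `…FiveTwo`),

into: **for every hairy cycle (`HairyCycle.IsHairyCycle`: cycle `c_0 = o, …, c_{L−1}` of length `L ≥ 3` through the observer, `K` hairs
`s(c_{b_k}, t_k)` with distinct tips off the cycle and monotone bases — several hairs per vertex and hairs at the observer allowed) with `K ≤ 5`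
hairs, every weight function supported on its `L + K` pairs and EVERY layer `j`:  `TwoCopy.FARp w {t_0, …, t_{K−1}} c_0 j`**, i.e.
`2j < Σ_k P(c_0 ↔ t_k)` and `P(c_0 ↮ t_k) ≤ t` for all `k` imply `P(#{k : c_0 ↔ t_k} ≤ j) ≤ t` — the body of `Quant.FarRelayRow` for these
supports and relay sets (`HairyCycle.farRelayRow_hairyCycle_le_five`).  Layers not covered by a certificate are vacuous (`2j ≥ K`,
`TwoCopy.FARp.of_card_le`) or layer `0` (`TwoCopy.FARp.zero`).  Before this file the kernel knew FAR on supports with a cycle only for `≤ 5`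
vertices (`TwoCopy.farRelayRow_of_card_le_five`).  `K = 6, 7` follow in `…LeSix` / `…LeSeven` (Kronecker-checked sun certificates); relays ON the cycle and pendant paths are not treated here.
No sorries; standard axioms; the only `decide`s identify the general sun graph `HairyCycle.sunEs K` with the certificate files' `sunK_es`.
[cite: KozmaNitzan2024, Lemma 2 (p. 6), Conjecture 3 (p. 15)] (context: the lower-tail family; FAR is this programme's statement).
-/

noncomputable section

namespace Summit.CriticalPhenomena.PercolationContinuityZ3.Theorems.HairyCycle

open Finset MeasureTheory
open Literature.Probability.Percolation Literature.Probability.LatticeModels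
open Summit.CriticalPhenomena.PercolationContinuityZ3.Theorems.AdditiveGluing.Negative.Cert
open Summit.CriticalPhenomena.PercolationContinuityZ3.Theorems.TwoCopy
open scoped Classical

/-! ## The sun graphs of the certificate files are `sunEs 3, 4, 5` -/

/-- `sunEs 3` is the certificate file's `sun3_es`. [this work] -/
theorem sunEs_three : sunEs 3 = sun3_es := by decide
/-- `sunAs 3` is the certificate file's `sun3_As`. [this work] -/
theorem sunAs_three : sunAs 3 = sun3_As := by decide
/-- `sunEs 4` is the certificate file's `sun4_es`. [this work] -/
theorem sunEs_four : sunEs 4 = sun4_es := by decide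
/-- `sunAs 4` is the certificate file's `sun4_As`. [this work] -/
theorem sunAs_four : sunAs 4 = sun4_As := by decide
/-- `sunEs 5` is the certificate file's `sun5_es`. [this work] -/
theorem sunEs_five : sunEs 5 = sun5_es := by decide
/-- `sunAs 5` is the certificate file's `sun5_As`. [this work] -/
theorem sunAs_five : sunAs 5 = sun5_As := by decide

/-- `sunCyc K 0 = 0`. [this work] -/
theorem sunCyc_zero (K : ℕ) : sunCyc K 0 = 0 := by
  unfold sunCyc
  ext
  simp

/-- The sun hypothesis of the segment reduction for `K = 3`, every layer. [this work] -/
theorem farp_sun_three (j : ℕ) (q : Sym2 (Fin (2 * 3 + 1)) → unitInterval) (hq : VanishesOff q (sunEs 3)) :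
    FARp q ((Finset.range 3).image (sunTip 3)) (sunCyc 3 0) j := by
  rw [← sunAs_toFinset, sunAs_three, sunCyc_zero]
  rw [sunEs_three] at hq
  rcases Nat.lt_or_ge j 1 with hj | hj
  · have : j = 0 := by omega
    subst this
    exact FARp.zero q _ _
  rcases Nat.lt_or_ge j 2 with hj2 | hj2
  · have : j = 1 := by omega
    subst this
    exact farp_sun3_j1 q hq
  · exact FARp.of_card_le q _ _ j ((List.toFinset_card_le _).trans (by simp [sun3_As]; omega))

/-- The sun hypothesis of the segment reduction for `K = 4`, every layer. [this work] -/
theorem farp_sun_four (j : ℕ) (q : Sym2 (Fin (2 * 4 + 1)) → unitInterval) (hq : VanishesOff q (sunEs 4)) :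
    FARp q ((Finset.range 4).image (sunTip 4)) (sunCyc 4 0) j := by
  rw [← sunAs_toFinset, sunAs_four, sunCyc_zero]
  rw [sunEs_four] at hq
  rcases Nat.lt_or_ge j 1 with hj | hj
  · have : j = 0 := by omega
    subst this
    exact FARp.zero q _ _
  rcases Nat.lt_or_ge j 2 with hj2 | hj2
  · have : j = 1 := by omega
    subst this
    exact farp_sun4_j1 q hq
  · exact FARp.of_card_le q _ _ j ((List.toFinset_card_le _).trans (by simp [sun4_As]; omega))

/-- The sun hypothesis of the segment reduction for `K = 5`, every layer. [this work] -/
theorem farp_sun_five (j : ℕ) (q : Sym2 (Fin (2 * 5 + 1)) → unitInterval) (hq : VanishesOff q (sunEs 5)) :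
    FARp q ((Finset.range 5).image (sunTip 5)) (sunCyc 5 0) j := by
  rw [← sunAs_toFinset, sunAs_five, sunCyc_zero]
  rw [sunEs_five] at hq
  rcases Nat.lt_or_ge j 1 with hj | hj
  · have : j = 0 := by omega
    subst this
    exact FARp.zero q _ _
  rcases Nat.lt_or_ge j 2 with hj2 | hj2
  · have : j = 1 := by omega
    subst this
    exact farp_sun5_j1 q hq
  rcases Nat.lt_or_ge j 3 with hj3 | hj3
  · have : j = 2 := by omega
    subst this
    exact farp_sun5_j2 q hq
  · exact FARp.of_card_le q _ _ j ((List.toFinset_card_le _).trans (by simp [sun5_As]; omega))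

/-! ## FAR on every hairy cycle with at most five hairs -/

variable {n : ℕ} {L : ℕ} {cyc : ℕ → Fin n} {K : ℕ} {base : ℕ → ℕ} {tip : ℕ → Fin n}

/-- **FAR on every hairy cycle with three hairs, every layer.** [this work] -/
theorem farp_hairyCycle_three (H : IsHairyCycle L cyc 3 base tip) (w : Sym2 (Fin n) → unitInterval)
    (hsupp : ∀ e : Sym2 (Fin n), ¬ e.IsDiag → w e ≠ 0 →
      (∃ i, i < L ∧ e = cycE L cyc i) ∨ (∃ k, k < 3 ∧ e = hairE cyc base tip k)) (j : ℕ) :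
    FARp w ((Finset.range 3).image tip) (cyc 0) j :=
  farp_of_sun H j (farp_sun_three j) w hsupp

/-- **FAR on every hairy cycle with four hairs, every layer.** [this work] -/
theorem farp_hairyCycle_four (H : IsHairyCycle L cyc 4 base tip) (w : Sym2 (Fin n) → unitInterval)
    (hsupp : ∀ e : Sym2 (Fin n), ¬ e.IsDiag → w e ≠ 0 →
      (∃ i, i < L ∧ e = cycE L cyc i) ∨ (∃ k, k < 4 ∧ e = hairE cyc base tip k)) (j : ℕ) :
    FARp w ((Finset.range 4).image tip) (cyc 0) j :=
  farp_of_sun H j (farp_sun_four j) w hsupp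

/-- **FAR on every hairy cycle with five hairs, every layer.** [this work] -/
theorem farp_hairyCycle_five (H : IsHairyCycle L cyc 5 base tip) (w : Sym2 (Fin n) → unitInterval)
    (hsupp : ∀ e : Sym2 (Fin n), ¬ e.IsDiag → w e ≠ 0 →
      (∃ i, i < L ∧ e = cycE L cyc i) ∨ (∃ k, k < 5 ∧ e = hairE cyc base tip k)) (j : ℕ) :
    FARp w ((Finset.range 5).image tip) (cyc 0) j :=
  farp_of_sun H j (farp_sun_five j) w hsupp

/-- **`Quant.FarRelayRow` ON EVERY HAIRY CYCLE WITH AT MOST FIVE HAIRS** (the row's body, verbatim, for these supports and relay sets):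
for a hairy cycle with `2 ≤ K ≤ 5` hairs (cycle `c_0 = o, …, c_{L−1}`, `L ≥ 3`, hairs `s(c_{b_k}, t_k)`), every weight function whose
non-loop support lies on the cycle and hair pairs, every layer `j` and every `t`: `2j < Σ_{k<K} P(c_0 ↔ t_k)` and `P(c_0 ↮ t_k) ≤ t`
for all `k < K` imply `P(#{k < K : c_0 ↔ t_k} ≤ j) ≤ t` (relay set = the finset of tips).  `K = 2` is vacuous. [this work] -/
theorem farRelayRow_hairyCycle_le_five (H : IsHairyCycle L cyc K base tip) (hK : K ≤ 5) (w : Sym2 (Fin n) → unitInterval)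
    (hsupp : ∀ e : Sym2 (Fin n), ¬ e.IsDiag → w e ≠ 0 →
      (∃ i, i < L ∧ e = cycE L cyc i) ∨ (∃ k, k < K ∧ e = hairE cyc base tip k))
    (j : ℕ) (t : ℝ)
    (hEN : (2 * j : ℝ) < ∑ a ∈ (Finset.range K).image tip, (prodBernoulli w).real (openConn (cyc 0) a))
    (hcut : ∀ a ∈ (Finset.range K).image tip, (prodBernoulli w).real (openConn (cyc 0) a)ᶜ ≤ t) :
    (prodBernoulli w).real {ω : BondConfig (Fin n) |
      (((Finset.range K).image tip).filter fun a => ω ∈ openConn (cyc 0) a).card ≤ j} ≤ t := by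
  have hK2 := H.hK
  have hfarp : FARp w ((Finset.range K).image tip) (cyc 0) j := by
    rcases Nat.lt_or_ge K 3 with h3 | h3
    · -- `K = 2`: vacuous unless `j = 0`
      have hK' : K = 2 := by omega
      subst hK'
      rcases Nat.eq_zero_or_pos j with rfl | hj
      · exact FARp.zero w _ _
      · exact FARp.of_card_le w _ _ j (Finset.card_image_le.trans (by rw [Finset.card_range]; omega))
    rcases Nat.lt_or_ge K 4 with h4 | h4
    · have hK' : K = 3 := by omega
      subst hK'; exact farp_hairyCycle_three H w hsupp j
    rcases Nat.lt_or_ge K 5 with h5 | h5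
    · have hK' : K = 4 := by omega
      subst hK'; exact farp_hairyCycle_four H w hsupp j
    · have hK' : K = 5 := by omega
      subst hK'; exact farp_hairyCycle_five H w hsupp j
  exact hfarp hEN t hcut

end Summit.CriticalPhenomena.PercolationContinuityZ3.Theorems.HairyCycle

end
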